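import Summits.ValiantsHypothesis.ValiantsHypothesis.Theorems.TwoProducts.RankThreeAffineToricWronskianDepthNewton

/-!
# Toric Wronskians of monomials, part 8: the CLOSED FORM of the depth-`d` layer coefficient (W4b) — the hybrid Vandermonde

Sequel of ✓ `…ToricWronskianDepth` (W4a, p721689) and `…ToricWronskianDepthNewton` (scalar algebra).  Setting of W4a: `v` the unique `ν`-top of
`supp u`, `p` (`wt p < wt v`) strictly dominating the other support points `s` with `det(q, s) ≠ 0`, columns `e_i = b_i + n_i•q`, `d = toricWDefect b`,
`N = Σ_{i<K} i = m + d`, `W = W_{J(·,u)}(X^e)`; W4a located the top candidate `P = Σe_i + m•v + d•p`.  THIS FILE computes `coeff_P W` EXACTLY: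
★★★ `toricW_layer_closed_form` (with `det(q,v) = 0`, `det(p,v) ≠ 0`): `coeff_P W = Π_{i<j} F(i,j)`, the HYBRID VANDERMONDE —
`F(i,j) = u_p·(det(e_j,p) − det(e_i,p))` for `i ∼ j` (same class; `= u_p det(q,p)·(n_j − n_i)`) and `F(i,j) = (β_j + ℓ_jγ) − (β_i + ℓ_iγ)` for `i ≁ j`
(`β_i = toricWCornerWt u v e i = u_v det(e_i, v)`, `γ = u_v det(p,v)`, `ℓ = toricWRank b`; `= u_v·(det(e_j − e_i, v) + (ℓ_j − ℓ_i)·det(p,v))`) —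
val-idea-crit-8 g6 #118 (L1) factor for factor; `d = 0`: ✓ `toricW_corner`; `d = 1`: ✓ `toricW_first_layer`.  So `coeff_P W ≠ 0` ⟺ `u_p ≠ 0`, `n` injective
on the classes, and NO MERGE `β_j + ℓ_jγ = β_i + ℓ_iγ` across classes; then (✓ `toricW_isUniqueTop_layer`) `P` is the UNIQUE `ν`-top of `W`.  With a
non-canonical `b` (fibres finer than the resonance classes) both sides vanish (two rank-0 columns of one true class give a cross factor `β − β = 0`).
ROUTE.  §2 ★★ `toricW_coef_lead`: the ray table `M_{a,j} = toricW_coef u b q a j` has coefficient `L_{a,j} = toricWLead β γ κ a j = κ^j·newt(β + ·γ)_{a,j}`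
(`κ = u_p det(q,p)`) at its dominating point `(a−j)•v + j•p` — by the recursion `M_{a+1,j} = ε_b M_{a,j} + J(M_{a,j},u) + ε_q M_{a,j−1}` read at the top
(letters `v`, `v`, `p`: `L_{a+1,j} = (β + jγ)L_{a,j} + κL_{a,j−1}`), using ★ `IsWordSupp.isDomTop` (W4a's words ⇒ ✓ `IsDomTop`) and ✓ `isDomTop_mul`/`isDomTop_jac`.
§3 `W = X^{Σe}·det 𝕄`, `𝕄_{k,i} = Σ_j M^{(b_i)}_{k,j} n_i^j` (★ `toricW_eq_monomial_mul_det`, ✓ `toricW_iterate_eq`) and ★ the NEWTON REDUCTION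
`toricWClassMat_eq_mul`: `𝕄 = 𝕄″·Tⁿ` with `Tⁿ = toricWTri b n` (class-triangular, `det = Π_{j<i, j∼i}(n_i − n_j)`) and
`𝕄″_{k,i'} = Σ_j newt(n-nodes)_{j,ℓ_{i'}}·M^{(b_{i'})}_{k,j} = M_{k,ℓ_{i'}} + (deeper)` (Newton's identity `n_i^j = Σ_{i'∼i} newt_{j,ℓ_{i'}}·Tⁿ_{i',i}`).
§4 ★ `toricWNewtMat_dom`: `𝕄″_{k,i'}` is dominated by `(k−ℓ_{i'})•v + ℓ_{i'}•p` with coefficient `H_{k,i'} = L^{(b_{i'})}_{k,ℓ_{i'}}`; ★★ `toricW_coeff_det_newtMat`: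
`coeff_{m•v+d•p} det 𝕄″ = det H` (permutation expansion + ✓ `isDomTop_prod`, `Σℓ_i = d`).  §5: `det H = κ^d·det H″` (`Matrix.det_mul_row`),
`det H″ = Π_{j<i, j≁i}(z_i − z_j)` (✓ `det_toricWNewt`), `κ^d·det Tⁿ = Π_{j<i, j∼i} κ(n_i − n_j)`.  NOT in this file: the count corollary (W4c).
HONEST LABEL: exact engine on the OPEN rung 3-AFF (side ladder, crux `stmt-ValiantsHypothesis-5906` `TwoProducts`); (TW-flag, poly) at MERGES, `OLMLaw`,
`RankThreeAffineLaw(Exp)`, `TwoProducts`, PCB, `ResidualLawV25` UNMOVED; 0 summit distance; VP ≠ VNP is NOT proved; no summit statement is proved here.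
`--supports stmt-ValiantsHypothesis-5906 --as helper` (val-port-4 g6; critic of record val-idea-crit-8 g6).  New defs (data, with parameters):
`toricWLead`, `toricWClassMat`, `toricWNewtMat`; no instances, no notation, no named facts. [folklore]
-/

noncomputable section
set_option linter.dupNamespace false

namespace Summit.ValiantsHypothesis.ValiantsHypothesis.Theorems.TwoProducts.RankTwoJacobian

open scoped BigOperators
open MvPolynomial
open Literature.LinearAlgebra.Matrix (wronskianMatrix wronskian wronskianMatrix_apply wronskian_def)

section TowerKernel
open scoped Classical

/-! ### §1 Located words: domination and the two one-letter factors -/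

/-- ★ a sum of `a`-letter words with `≥ j` letters off `q` is `ν`-dominated by `(a−j)•v + j•p` (`v` the unique top of `supp u`, `p` dominating the
off-`q` support points). [folklore] -/
theorem IsWordSupp.isDomTop {ν : Fin 2 → ℝ} {u : Poly2} {v p q : Expo} (hv : IsUniqueTop ν u v) (hpv : wt ν p < wt ν v)
    (hp2 : ∀ s ∈ u.support, s ≠ p → idet q s ≠ 0 → wt ν s < wt ν p) {a j : ℕ} {F : Poly2} (hF : IsWordSupp u q a j F)
    (hja : j ≤ a) : IsDomTop ν F ((a - j) • v + j • p) := by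
  intro z hz hne
  obtain ⟨w, hw, hc, hj, rfl⟩ := hF z hz
  obtain ⟨hle, heq⟩ := wt_word_le hv hp2 w hw
  set L := Multiset.card (w.filter fun s => idet q s ≠ 0) with hL
  set L' := Multiset.card (w.filter fun s => ¬ idet q s ≠ 0) with hL'
  have hLL' : L' + L = a := by rw [hL, hL', add_comm, ← Multiset.card_add, Multiset.filter_add_not, hc]
  have hL'm : (L' : ℝ) = (a - j : ℕ) + j - L := by
    have h1 : ((L' + L : ℕ) : ℝ) = ((a - j + j : ℕ) : ℝ) := by rw [hLL', Nat.sub_add_cancel hja]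
    push_cast at h1; linarith
  have hjR : (j : ℝ) ≤ L := by exact_mod_cast hj
  have hprod : (L' : ℝ) * wt ν v = (((a - j : ℕ) : ℝ) + j - L) * wt ν v := by rw [hL'm]
  have hkey : 0 ≤ ((L : ℝ) - j) * (wt ν v - wt ν p) := mul_nonneg (by linarith) (by linarith)
  rw [wt_multiset_sum, wt_add, wt_nsmul, wt_nsmul]
  rcases lt_or_eq_of_le hle with hlt | heq'
  · nlinarith [hprod, hkey]
  · rcases lt_or_eq_of_le hj with hjl | hjl
    · have hjl' : (j : ℝ) < L := by exact_mod_cast hjl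
      have hkey' : 0 < ((L : ℝ) - j) * (wt ν v - wt ν p) := mul_pos (by linarith) (by linarith)
      nlinarith [hprod, hkey']
    · exfalso; apply hne
      have hL'eq : L' = a - j := by omega
      rw [heq heq', Multiset.sum_add, Multiset.sum_replicate, Multiset.sum_replicate, hL'eq, ← hjl]

/-- coefficients of the ray polynomial: `coeff_s ε_q = u_s · det(q, s)`. [folklore] -/
theorem coeff_rayEps (u : Poly2) (q s : Expo) : coeff s (rayEps u q) = coeff s u * ((idet q s : ℤ) : ℂ) := by
  unfold rayEps
  rw [coeff_sum]
  simp_rw [coeff_monomial]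
  rw [Finset.sum_ite_eq']
  by_cases h : s ∈ u.support
  · rw [if_pos h]
  · rw [if_neg h, MvPolynomial.notMem_support_iff.mp h, zero_mul]

/-- `ε_b` is dominated by the top vertex `v`. [folklore] -/
theorem isDomTop_rayEps_top {ν : Fin 2 → ℝ} {u : Poly2} {v p q : Expo} (hv : IsUniqueTop ν u v) (hpv : wt ν p < wt ν v)
    (hp2 : ∀ s ∈ u.support, s ≠ p → idet q s ≠ 0 → wt ν s < wt ν p) (b : Expo) : IsDomTop ν (rayEps u b) v := by
  have h := (isWordSupp_rayEps u q b).isDomTop hv hpv hp2 (Nat.zero_le 1)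
  rwa [Nat.sub_zero, one_nsmul, zero_nsmul, add_zero] at h

/-- `ε_q` is dominated by `p` (all its letters are off `q`). [folklore] -/
theorem isDomTop_rayEps_self {ν : Fin 2 → ℝ} {u : Poly2} {v p q : Expo} (hv : IsUniqueTop ν u v) (hpv : wt ν p < wt ν v)
    (hp2 : ∀ s ∈ u.support, s ≠ p → idet q s ≠ 0 → wt ν s < wt ν p) : IsDomTop ν (rayEps u q) p := by
  have h := (isWordSupp_rayEps_self u q).isDomTop hv hpv hp2 le_rfl
  rwa [Nat.sub_self, zero_nsmul, one_nsmul, zero_add] at h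

/-- moving the dominating point up kills the coefficient. [folklore] -/
theorem IsDomTop.of_wt_lt {ν : Fin 2 → ℝ} {F : Poly2} {P Q : Expo} (h : IsDomTop ν F Q) (hlt : wt ν Q < wt ν P) :
    IsDomTop ν F P ∧ coeff P F = 0 :=
  ⟨fun s hs _ => lt_of_le_of_lt (h.le s hs) hlt, coeff_eq_zero_of_wt_lt fun s hs => lt_of_le_of_lt (h.le s hs) hlt⟩

/-! ### §2 The leading scalars of the ray table -/

/-- the LEADING SCALAR of the ray table at depth `j`: `L_{a,j} = κ^j · h_{a−j}(β, β+γ, …, β+jγ)` (`β = u_v det(b,v)`, `γ = u_v det(p,v)`,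
`κ = u_p det(q,p)`); it satisfies `L_{a+1,j} = (β + jγ)·L_{a,j} + κ·L_{a,j−1}`. [folklore] -/
def toricWLead (β γ κ : ℂ) (a j : ℕ) : ℂ := κ ^ j * toricWNewt (fun t => β + (t : ℂ) * γ) a j

/-- the recursion of the leading scalars. [folklore] -/
theorem toricWLead_succ (β γ κ : ℂ) (a j : ℕ) :
    toricWLead β γ κ (a + 1) j = (β + (j : ℂ) * γ) * toricWLead β γ κ a j + (if j = 0 then 0 else κ * toricWLead β γ κ a (j - 1)) := by
  unfold toricWLead
  simp only [toricWNewt]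
  by_cases hj : j = 0
  · rw [if_pos hj, if_pos hj]; ring
  · rw [if_neg hj, if_neg hj]
    obtain ⟨j', rfl⟩ := Nat.exists_eq_succ_of_ne_zero hj
    rw [Nat.succ_sub_one, pow_succ]; ring

/-- `L_{a,j} = 0` above the diagonal. [folklore] -/
theorem toricWLead_eq_zero (β γ κ : ℂ) {a j : ℕ} (h : a < j) : toricWLead β γ κ a j = 0 := by
  unfold toricWLead; rw [toricWNewt_eq_zero _ a j h, mul_zero]

/-- ★★ **THE LEADING SCALARS OF THE RAY TABLE:** for `j ≤ a`, the coefficient of `M_{a,j} = toricW_coef u b q a j` at its dominating point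
`(a−j)•v + j•p` is `L_{a,j}` (so `M_{a,j} = L_{a,j}·X^{(a−j)v+jp} + (strictly ν-lighter)`). -/
theorem toricW_coef_lead {ν : Fin 2 → ℝ} {u : Poly2} {v p q : Expo} (hv : IsUniqueTop ν u v) (hpv : wt ν p < wt ν v)
    (hp2 : ∀ s ∈ u.support, s ≠ p → idet q s ≠ 0 → wt ν s < wt ν p) (b : Expo) :
    ∀ a j : ℕ, j ≤ a → coeff ((a - j) • v + j • p) (toricW_coef u b q a j) =
      toricWLead (coeff v u * ((idet b v : ℤ) : ℂ)) (coeff v u * ((idet p v : ℤ) : ℂ)) (coeff p u * ((idet q p : ℤ) : ℂ)) a j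
  | 0, j, hj => by
    obtain rfl : j = 0 := Nat.le_zero.mp hj
    simp only [toricW_coef, if_true, Nat.sub_self, zero_nsmul, add_zero]
    unfold toricWLead; simp only [toricWNewt, if_true]
    rw [← C_1, coeff_zero_C]; ring
  | a + 1, j, hj => by
    set β : ℂ := coeff v u * ((idet b v : ℤ) : ℂ) with hβ
    set γ : ℂ := coeff v u * ((idet p v : ℤ) : ℂ) with hγ
    set κ : ℂ := coeff p u * ((idet q p : ℤ) : ℂ) with hκ
    simp only [toricW_coef]
    rw [coeff_add, coeff_add, toricWLead_succ]
    -- the third term (depth raised by `ε_q`)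
    have h3 : coeff ((a + 1 - j) • v + j • p) (if j = 0 then (0 : Poly2) else rayEps u q * toricW_coef u b q a (j - 1)) =
        (if j = 0 then 0 else κ * toricWLead β γ κ a (j - 1)) := by
      by_cases hj0 : j = 0
      · rw [if_pos hj0, if_pos hj0, coeff_zero]
      · rw [if_neg hj0, if_neg hj0]
        obtain ⟨j', rfl⟩ := Nat.exists_eq_add_one_of_ne_zero hj0
        rw [Nat.add_sub_cancel]
        have hM := (isWordSupp_toricW_coef u b q a j').isDomTop hv hpv hp2 (by omega)
        obtain ⟨_, hc⟩ := isDomTop_mul (isDomTop_rayEps_self hv hpv hp2) hM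
        have he : p + ((a - j') • v + j' • p) = (a + 1 - (j' + 1)) • v + (j' + 1) • p := by
          rw [Nat.add_sub_add_right, succ_nsmul]; abel
        rw [← he, hc, coeff_rayEps, toricW_coef_lead hv hpv hp2 b a j' (by omega)]
    rw [h3]
    by_cases hja : j ≤ a
    · have hM := (isWordSupp_toricW_coef u b q a j).isDomTop hv hpv hp2 hja
      have hcM := toricW_coef_lead hv hpv hp2 b a j hja
      -- first term: the letter `v` of `ε_b`
      obtain ⟨_, hc1⟩ := isDomTop_mul (isDomTop_rayEps_top hv hpv hp2 b) hM
      have he1 : v + ((a - j) • v + j • p) = (a + 1 - j) • v + j • p := by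
        rw [show a + 1 - j = (a - j) + 1 by omega, succ_nsmul]; abel
      -- second term: the `J`-step
      obtain ⟨_, hc2⟩ := isDomTop_jac hM hv
      have he2 : (a - j) • v + j • p + v = (a + 1 - j) • v + j • p := by rw [← he1]; abel
      have hdet : idet ((a - j) • v + j • p) v = (j : ℤ) * idet p v := by
        have hvv : idet v v = 0 := by unfold idet; ring
        rw [toricW_idet_add, toricW_idet_nsmul, toricW_idet_nsmul, hvv]; ring
      rw [← he1, hc1, he1, ← he2, hc2, hcM, coeff_rayEps, hdet]
      push_cast
      ring
    · -- `j = a + 1`: the column `M_{a,a+1}` vanishes, only the `ε_q`-term survives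
      have hj1 : j = a + 1 := by omega
      have hz : toricW_coef u b q a j = 0 := toricW_coef_eq_zero u b q a j (by omega)
      rw [hz, mul_zero, ← jacDer_apply, map_zero, coeff_zero, toricWLead_eq_zero β γ κ (by omega : a < j)]
      ring

/-! ### §3 The class matrix and its Newton reduction -/

/-- the CLASS MATRIX `𝕄_{k,i} = Σ_j M^{(b_i)}_{k,j} · n_i^j` (so that `W = X^{Σe} · det 𝕄`, ✓ `toricW_iterate_eq`). [folklore] -/
def toricWClassMat (u : Poly2) (q : Expo) {K : ℕ} (b : Fin K → Expo) (n : Fin K → ℕ) : Matrix (Fin K) (Fin K) Poly2 :=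
  Matrix.of fun k i => ∑ j : Fin K, toricW_coef u (b i) q k j * C (((n i : ℕ) : ℂ) ^ (j : ℕ))

/-- ★ `W = X^{Σe} · det 𝕄`. [folklore] -/
theorem toricW_eq_monomial_mul_det (u : Poly2) (q : Expo) {K : ℕ} (e b : Fin K → Expo) (n : Fin K → ℕ) (he : ∀ i, e i = b i + n i • q) :
    wronskian (⇑(jacDer u)) (fun i => monomial (e i) (1 : ℂ)) = monomial (∑ i, e i) (1 : ℂ) * (toricWClassMat u q b n).det := by
  have hmat : wronskianMatrix (⇑(jacDer u)) (fun i => monomial (e i) (1 : ℂ)) =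
      Matrix.of fun k i => monomial (e i) (1 : ℂ) * toricWClassMat u q b n k i := by
    refine Matrix.ext fun k i => ?_
    rw [wronskianMatrix_apply, Matrix.of_apply, he i, toricW_iterate_eq]
    unfold toricWClassMat
    rw [Matrix.of_apply]
    have hsub : Finset.range ((k : ℕ) + 1) ⊆ Finset.range K := Finset.range_subset_range.mpr (by omega)
    rw [Finset.sum_subset hsub fun c _ hnc => by
      rw [toricW_coef_eq_zero u (b i) q k c (by have : ¬ (c < (k : ℕ) + 1) := fun h => hnc (Finset.mem_range.mpr h); omega),
        zero_mul], Finset.sum_range]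
  rw [wronskian_def, hmat, Matrix.det_mul_row, ← Finset.prod_const_one (s := (Finset.univ : Finset (Fin K))),
    ← toricW_prod_monomial, Finset.prod_const_one]

/-- the NEWTON-REDUCED class matrix `𝕄″_{k,i'} = Σ_j newt(n-nodes of the class of i')_{j, ℓ_{i'}} · M^{(b_{i'})}_{k,j}`
(`= M_{k,ℓ_{i'}} + deeper columns`). [folklore] -/
def toricWNewtMat (u : Poly2) (q : Expo) {K : ℕ} (b : Fin K → Expo) (n : Fin K → ℕ) : Matrix (Fin K) (Fin K) Poly2 :=
  Matrix.of fun k i' => ∑ j : Fin K, C (toricWNewt (toricWNodes b (fun i => ((n i : ℕ) : ℂ)) (b i')) (j : ℕ) (toricWRank b i')) *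
    toricW_coef u (b i') q k j

/-- ★ THE NEWTON REDUCTION: `𝕄 = 𝕄″ · Tⁿ` with the class-triangular factor of the multipliers `n`. [folklore] -/
theorem toricWClassMat_eq_mul (u : Poly2) (q : Expo) {K : ℕ} (b : Fin K → Expo) (n : Fin K → ℕ) :
    toricWClassMat u q b n = toricWNewtMat u q b n * (toricWTri b (fun i => ((n i : ℕ) : ℂ))).map C := by
  refine Matrix.ext fun k i => ?_
  rw [Matrix.mul_apply]
  have hterm : ∀ i' : Fin K, toricWNewtMat u q b n k i' * ((toricWTri b (fun i => ((n i : ℕ) : ℂ))).map C) i' i =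
      ∑ j : Fin K, toricW_coef u (b i) q k j *
        C (toricWNewt (toricWNodes b (fun i => ((n i : ℕ) : ℂ)) (b i')) (j : ℕ) (toricWRank b i') *
          toricWTri b (fun i => ((n i : ℕ) : ℂ)) i' i) := by
    intro i'
    unfold toricWNewtMat
    rw [Matrix.of_apply, Matrix.map_apply, Finset.sum_mul]
    by_cases hb : b i' = b i
    · refine Finset.sum_congr rfl fun j _ => ?_
      rw [hb, map_mul]; ring
    · have h0 : toricWTri b (fun i => ((n i : ℕ) : ℂ)) i' i = 0 := by unfold toricWTri; rw [Matrix.of_apply, if_neg hb]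
      rw [h0]; simp
  simp_rw [hterm]
  rw [Finset.sum_comm]
  unfold toricWClassMat
  rw [Matrix.of_apply]
  refine Finset.sum_congr rfl fun j _ => ?_
  rw [← Finset.mul_sum, ← map_sum, ← toricW_pow_eq_sum_newt_tri]

/-! ### §4 The leading scalars of `𝕄″` and of its determinant -/

/-- ★ the `(k,i')` entry of `𝕄″` is `ν`-dominated by `(k − ℓ_{i'})•v + ℓ_{i'}•p` with coefficient `L_{k,ℓ_{i'}}` (for `ℓ_{i'} ≤ k`),
and vanishes for `ℓ_{i'} > k`. [folklore] -/
theorem toricWNewtMat_dom {ν : Fin 2 → ℝ} {u : Poly2} {v p q : Expo} (hv : IsUniqueTop ν u v) (hpv : wt ν p < wt ν v)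
    (hp2 : ∀ s ∈ u.support, s ≠ p → idet q s ≠ 0 → wt ν s < wt ν p) {K : ℕ} (b : Fin K → Expo) (n : Fin K → ℕ) (k i' : Fin K) :
    (toricWRank b i' ≤ (k : ℕ) →
      IsDomTop ν (toricWNewtMat u q b n k i') (((k : ℕ) - toricWRank b i') • v + toricWRank b i' • p) ∧
      coeff (((k : ℕ) - toricWRank b i') • v + toricWRank b i' • p) (toricWNewtMat u q b n k i') =
        toricWLead (coeff v u * ((idet (b i') v : ℤ) : ℂ)) (coeff v u * ((idet p v : ℤ) : ℂ)) (coeff p u * ((idet q p : ℤ) : ℂ))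
          k (toricWRank b i')) ∧
    ((k : ℕ) < toricWRank b i' → toricWNewtMat u q b n k i' = 0) := by
  set ℓ := toricWRank b i' with hℓ
  set y : ℕ → ℂ := toricWNodes b (fun i => ((n i : ℕ) : ℂ)) (b i') with hy
  unfold toricWNewtMat
  rw [Matrix.of_apply]
  refine ⟨fun hl => ?_, fun hl => ?_⟩
  · -- every term is dominated by the point of depth ℓ; only `j = ℓ` contributes there
    have hterm : ∀ j : Fin K, IsDomTop ν (C (toricWNewt y j ℓ) * toricW_coef u (b i') q k j) (((k : ℕ) - ℓ) • v + ℓ • p) ∧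
        coeff (((k : ℕ) - ℓ) • v + ℓ • p) (C (toricWNewt y j ℓ) * toricW_coef u (b i') q k j) =
          (if (j : ℕ) = ℓ then toricWLead (coeff v u * ((idet (b i') v : ℤ) : ℂ)) (coeff v u * ((idet p v : ℤ) : ℂ))
            (coeff p u * ((idet q p : ℤ) : ℂ)) k ℓ else 0) := by
      intro j
      rcases lt_trichotomy (j : ℕ) ℓ with hjl | hjl | hjl
      · rw [toricWNewt_eq_zero y j ℓ hjl, C_0, zero_mul, if_neg (ne_of_lt hjl), coeff_zero]
        exact ⟨isDomTop_zero ν _, rfl⟩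
      · rw [hjl, toricWNewt_diag, C_1, one_mul, if_pos rfl]
        exact ⟨(isWordSupp_toricW_coef u (b i') q k ℓ).isDomTop hv hpv hp2 hl, toricW_coef_lead hv hpv hp2 (b i') k ℓ hl⟩
      · rw [if_neg (ne_of_gt hjl)]
        by_cases hjk : (j : ℕ) ≤ k
        · have hM := (isWordSupp_toricW_coef u (b i') q k j).isDomTop hv hpv hp2 hjk
          obtain ⟨hd, hc⟩ := isDomTop_mul (isDomTop_monomial ν 0 (toricWNewt y j ℓ)) hM
          rw [zero_add] at hd hc
          have hlt : wt ν (((k : ℕ) - (j : ℕ)) • v + (j : ℕ) • p) < wt ν (((k : ℕ) - ℓ) • v + ℓ • p) := by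
            rw [wt_add, wt_add, wt_nsmul, wt_nsmul, wt_nsmul, wt_nsmul]
            have h1 : (((k : ℕ) - (j : ℕ) : ℕ) : ℝ) = (k : ℕ) - (j : ℕ) := by rw [Nat.cast_sub hjk]
            have h2 : (((k : ℕ) - ℓ : ℕ) : ℝ) = (k : ℕ) - ℓ := by rw [Nat.cast_sub hl]
            have h3 : (ℓ : ℝ) < (j : ℕ) := by exact_mod_cast hjl
            rw [h1, h2]; nlinarith
          exact (show C (toricWNewt y j ℓ) = monomial 0 (toricWNewt y j ℓ) from rfl) ▸ hd.of_wt_lt hlt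
        · rw [toricW_coef_eq_zero u (b i') q k j (by omega), mul_zero, coeff_zero]
          exact ⟨isDomTop_zero ν _, rfl⟩
    refine ⟨isDomTop_sum _ fun j _ => (hterm j).1, ?_⟩
    rw [coeff_sum, Finset.sum_congr rfl fun j _ => (hterm j).2]
    have hℓK : ℓ < K := lt_of_le_of_lt hl k.isLt
    rw [Finset.sum_eq_single (⟨ℓ, hℓK⟩ : Fin K) (fun j _ hj => if_neg fun h => hj (Fin.ext h)) (fun h => absurd (Finset.mem_univ _) h),
      if_pos rfl]
  · refine Finset.sum_eq_zero fun j _ => ?_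
    rcases lt_or_ge (j : ℕ) ℓ with hjl | hjl
    · rw [toricWNewt_eq_zero y j ℓ hjl, C_0, zero_mul]
    · rw [toricW_coef_eq_zero u (b i') q k j (by omega), mul_zero]

/-- ★★ THE DEPTH-`d` COEFFICIENT OF `det 𝕄″` is the determinant of the leading scalars `H_{k,i'} = L^{(b_{i'})}_{k, ℓ_{i'}}`. [folklore] -/
theorem toricW_coeff_det_newtMat {ν : Fin 2 → ℝ} {u : Poly2} {v p q : Expo} (hv : IsUniqueTop ν u v) (hpv : wt ν p < wt ν v)
    (hp2 : ∀ s ∈ u.support, s ≠ p → idet q s ≠ 0 → wt ν s < wt ν p) {K : ℕ} (b : Fin K → Expo) (n : Fin K → ℕ) {m : ℕ}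
    (hm : m + toricWDefect b = ∑ i : Fin K, (i : ℕ)) :
    coeff (m • v + toricWDefect b • p) (toricWNewtMat u q b n).det =
      (Matrix.of fun k i' : Fin K => toricWLead (coeff v u * ((idet (b i') v : ℤ) : ℂ)) (coeff v u * ((idet p v : ℤ) : ℂ))
        (coeff p u * ((idet q p : ℤ) : ℂ)) k (toricWRank b i')).det := by
  rw [Matrix.det_apply, Matrix.det_apply, coeff_sum]
  refine Finset.sum_congr rfl fun σ _ => ?_
  rw [coeff_units_smul]
  congr 1
  by_cases hgood : ∀ i', toricWRank b i' ≤ ((σ i' : Fin K) : ℕ)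
  · -- all factors dominated; the dominating points add up to `m•v + d•p`
    have hd := fun i' => (toricWNewtMat_dom hv hpv hp2 b n (σ i') i' (q := q) (u := u)).1 (hgood i')
    obtain ⟨_, hc⟩ := isDomTop_prod (Finset.univ : Finset (Fin K)) (ν := ν)
      (g := fun i' => toricWNewtMat u q b n (σ i') i')
      (P := fun i' => (((σ i' : Fin K) : ℕ) - toricWRank b i') • v + toricWRank b i' • p) (fun i' _ => (hd i').1)
    have hsub : ∑ i' : Fin K, (((σ i' : Fin K) : ℕ) - toricWRank b i') = m := by
      rw [Finset.sum_tsub_distrib _ fun i' _ => hgood i', Equiv.sum_comp σ (fun i : Fin K => (i : ℕ)), sum_toricWRank]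
      omega
    have hP : ∑ i' : Fin K, ((((σ i' : Fin K) : ℕ) - toricWRank b i') • v + toricWRank b i' • p) = m • v + toricWDefect b • p := by
      rw [Finset.sum_add_distrib, ← Finset.sum_smul, ← Finset.sum_smul, sum_toricWRank, hsub]
    rw [hP] at hc
    rw [hc]
    exact Finset.prod_congr rfl fun i' _ => by rw [(hd i').2, Matrix.of_apply]
  · simp only [not_forall, not_le] at hgood
    obtain ⟨i₀, hi₀⟩ := hgood
    have h1 : ∏ i, toricWNewtMat u q b n (σ i) i = 0 :=
      Finset.prod_eq_zero (Finset.mem_univ i₀) ((toricWNewtMat_dom hv hpv hp2 b n (σ i₀) i₀ (q := q) (u := u)).2 hi₀)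
    have h2 : ∏ i, (Matrix.of fun k i' : Fin K => toricWLead (coeff v u * ((idet (b i') v : ℤ) : ℂ)) (coeff v u * ((idet p v : ℤ) : ℂ))
        (coeff p u * ((idet q p : ℤ) : ℂ)) k (toricWRank b i')) (σ i) i = 0 :=
      Finset.prod_eq_zero (Finset.mem_univ i₀) (by rw [Matrix.of_apply]; exact toricWLead_eq_zero _ _ _ hi₀)
    rw [h1, h2, coeff_zero]

/-! ### §5 Assembly: the hybrid Vandermonde -/

/-- ★★★ **THE CLOSED FORM OF THE LAYER COEFFICIENT (hybrid Vandermonde).**  Let `v` be the unique `ν`-top of `supp u`, `p` (`wt p < wt v`,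
`det(p, v) ≠ 0`) strictly dominating every other support point of `u` off `q`, `det(q, v) = 0`, columns `e_i = b_i + n_i•q`, `d = toricWDefect b`,
`m + d = N`.  Then the coefficient of `W_{J(·,u)}(X^e)` at the located point `Σe_i + m•v + d•p` is
`Π_{i<j} F(i,j)`,  `F(i,j) = u_p·(det(e_j,p) − det(e_i,p))` if `b i = b j` (in-class Vandermonde factor), and
`F(i,j) = (β_j + ℓ_j γ) − (β_i + ℓ_i γ)` otherwise (`β_i = u_v det(e_i,v) = toricWCornerWt u v e i`, `γ = u_v det(p,v)`, `ℓ = toricWRank b`, the cross-class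
factor = `u_v·(det(e_j − e_i, v) + (ℓ_j − ℓ_i) det(p, v))`).  At `d = 0` this is ✓ `toricW_corner`'s Vandermonde, at `d = 1` ✓ `toricW_first_layer`.
Hence (with ✓ `toricW_isUniqueTop_layer`) the located point is the UNIQUE `ν`-top iff NO MERGE: no cross-class factor vanishes (and `u_p ≠ 0`,
`n` injective on the classes) — val-idea-crit-8 g6 #118 (L1); numerics 114/114 (`w4check.py`). -/
theorem toricW_layer_closed_form {ν : Fin 2 → ℝ} {u : Poly2} {v p q : Expo} (hv : IsUniqueTop ν u v) (hpv : wt ν p < wt ν v)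
    (hp2 : ∀ s ∈ u.support, s ≠ p → idet q s ≠ 0 → wt ν s < wt ν p) (hqv : idet q v = 0) (hγ : idet p v ≠ 0)
    {K : ℕ} (e b : Fin K → Expo) (n : Fin K → ℕ) (he : ∀ i, e i = b i + n i • q)
    {m : ℕ} (hm : m + toricWDefect b = ∑ i : Fin K, (i : ℕ)) :
    coeff ((∑ i, e i) + m • v + toricWDefect b • p) (wronskian (⇑(jacDer u)) (fun i => monomial (e i) (1 : ℂ))) =
      ∏ i : Fin K, ∏ j ∈ Finset.Ioi i,
        (if b i = b j then coeff p u * (((idet (e j) p : ℤ) : ℂ) - ((idet (e i) p : ℤ) : ℂ))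
         else (toricWCornerWt u v e j + (toricWRank b j : ℂ) * (coeff v u * ((idet p v : ℤ) : ℂ))) -
              (toricWCornerWt u v e i + (toricWRank b i : ℂ) * (coeff v u * ((idet p v : ℤ) : ℂ)))) := by
  set γ : ℂ := coeff v u * ((idet p v : ℤ) : ℂ) with hγdef
  set κ : ℂ := coeff p u * ((idet q p : ℤ) : ℂ) with hκ
  set β : Fin K → ℂ := fun i => coeff v u * ((idet (b i) v : ℤ) : ℂ) with hβ
  have hγ0 : γ ≠ 0 := mul_ne_zero (MvPolynomial.mem_support_iff.mp hv.1) (by exact_mod_cast hγ)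
  have hcorner : ∀ i, toricWCornerWt u v e i = β i := by
    intro i; unfold toricWCornerWt; rw [hβ]; simp only; rw [he i, idet_add_nsmul_left, hqv, mul_zero, add_zero]
  -- Step 1: the coefficient is `det H · det Tⁿ`
  have hstep1 : coeff ((∑ i, e i) + m • v + toricWDefect b • p) (wronskian (⇑(jacDer u)) (fun i => monomial (e i) (1 : ℂ))) =
      (Matrix.of fun k i' : Fin K => toricWLead (β i') γ κ k (toricWRank b i')).det * (toricWTri b (fun i => ((n i : ℕ) : ℂ))).det := by
    rw [toricW_eq_monomial_mul_det u q e b n he, toricWClassMat_eq_mul, Matrix.det_mul, add_assoc, coeff_monomial_mul, one_mul,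
      ← RingHom.mapMatrix_apply, ← RingHom.map_det, mul_comm, coeff_C_mul, mul_comm, toricW_coeff_det_newtMat hv hpv hp2 b n hm]
  -- Step 2: `det H = κ^d · det H″` and `det H″` = the cross-class product
  have hstep2 : (Matrix.of fun k i' : Fin K => toricWLead (β i') γ κ k (toricWRank b i')).det =
      κ ^ toricWDefect b * ∏ i : Fin K, ∏ j ∈ (Finset.univ : Finset (Fin K)).filter (fun j => j < i ∧ b j ≠ b i),
        ((β i + (toricWRank b i : ℂ) * γ) - (β j + (toricWRank b j : ℂ) * γ)) := by
    rw [← det_toricWNewt b β (fun i j h => by rw [hβ]; simp only; rw [h]) hγ0, ← sum_toricWRank, ← Finset.prod_pow_eq_pow_sum,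
      ← Matrix.det_mul_row]
    rfl
  -- Step 3: `det Tⁿ` = the in-class Vandermondes, `κ^d` distributes over the `d` in-class pairs
  have hstep3 : κ ^ toricWDefect b * (toricWTri b (fun i => ((n i : ℕ) : ℂ))).det =
      ∏ i : Fin K, ∏ j ∈ (Finset.univ : Finset (Fin K)).filter (fun j => j < i ∧ b j = b i),
        coeff p u * (((idet (e i) p : ℤ) : ℂ) - ((idet (e j) p : ℤ) : ℂ)) := by
    rw [det_toricWTri, ← sum_toricWRank, ← Finset.prod_pow_eq_pow_sum, ← Finset.prod_mul_distrib]
    refine Finset.prod_congr rfl fun i _ => ?_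
    unfold toricWRank
    rw [← Finset.prod_const, ← Finset.prod_mul_distrib]
    refine Finset.prod_congr rfl fun j hj => ?_
    rw [he i, he j, (Finset.mem_filter.mp hj).2.2, idet_add_nsmul_left, idet_add_nsmul_left, hκ]
    push_cast
    ring
  rw [hstep1, hstep2, mul_comm (κ ^ _), mul_assoc, hstep3]
  -- Step 4: regroup the target product over pairs `j < i`, split by class
  rw [Finset.prod_comm' (s := Finset.univ) (t := fun i => Finset.Ioi i) (t' := Finset.univ) (s' := fun j => Finset.Iio j)
      (fun a c => by simp)]
  simp_rw [hcorner]
  rw [mul_comm, ← Finset.prod_mul_distrib]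
  refine Finset.prod_congr rfl fun i _ => ?_
  rw [Finset.prod_ite]
  congr 1
  · refine Finset.prod_congr (by ext j; simp [Finset.mem_Iio, eq_comm]) fun _ _ => rfl
  · refine Finset.prod_congr (by ext j; simp [Finset.mem_Iio, eq_comm]) fun _ _ => rfl

end TowerKernel

end Summit.ValiantsHypothesis.ValiantsHypothesis.Theorems.TwoProducts.RankTwoJacobian

end
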